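import Mathlib
import Literature.Computability.Complexity.RangeAvoidance
import Literature.Computability.Complexity.SignDegreeXor
import HarnessLib.Audit
import Summits.PneNP.PneNP.Theorems.PstarPairwise
import Summits.PneNP.PneNP.Theorems.PstarSALevel
import Summits.PneNP.PneNP.Theorems.PstarSASDPLevel

/-!
# Biased pairwise independence ⇒ linear-level Sherali–Adams feasibility: the abstract target (cell `pnp-ideate`, ROUND-22 hub T22.0)

FRONTIER range-avoidance ladder, rung F-N3 context (restricted-model lower bounds for the Sherali–Adams hierarchy — nothing
here bears on `P` vs `NP`).

ROUND-21 proved (`PstarTypedSALinearLevel.typedSALinearLevel`, `…Prime.typedSALinearLevel'`) that on boundary-expanding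
TYPED pure-`P⋆` instances every fibre is Sherali–Adams feasible at linear level, by transcribing Benabbas–Georgiou–Magen–
Tulsiani (Theory Comput. 8 (2012) 269–289, §3) with BALANCED pairwise independence replaced by pairwise independence with
TYPE-CONSISTENT BIASES.  Nothing in that proof is specific to `P⋆`: it uses, per output `j`, a law on the `k` slot values that
is supported on the fibre of `y j`, has slot marginals `Bernoulli(p_v)` depending only on the VARIABLE `v` read (not on `j` or
the slot), and has independent slot pairs; plus `(r, ρ)`-boundary expansion with `ρ > k - 3` (so that the closure of BGMT
Thm 3.1 leaves every small non-dominated family a member with `≥ k - 2` private variables, on whose `≤ 2` remaining slots the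
law factors).  This file types that abstraction as the ROUND-22 hub target:

* `marg1`, `marg2` — one- and two-slot marginals of a weight on `{0,1}^k` (for `k = 4` these are `PstarPairwise.pr1/pr2`
  verbatim);
* `PairwiseLaws I y p μ` — a system of pairwise-independent fibre laws with variable-consistent biases `p` for `I(x) = y`;
* `SAFeasibleAt θ t I y` — level-`t` Sherali–Adams feasibility in the STRONG form: the local law on `S` satisfies every output
  constraint having at least `θ` of its variables inside `S` (`θ =` arity, i.e. all of them, is `PstarSALevel.SAFeasible`;
  the BGMT construction delivers `θ = 3`, because the closure at ratio `> k - 3` applied to a singleton family forces every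
  non-dominated output to meet the closed set in `≤ 2` variables) — this strong form is what transfers feasibility from a
  coarse constraint system (blocks) to a finer one (the 6-local triangle equations of a cycle quotient, ROUND-22 §12b);
* `PairwiseSALinearLevel` (conjecture / target T22.0): for every arity `k ≥ 3` and ratio `a/b > k - 3` there is `c > 0` with
  `PairwiseLaws I y p μ → BoundaryExpandingQ a b r I → SAFeasibleAt 3 (r / c) I y` for all `k`-local `I` with injective slots.

Instances (targets of ROUND-22, typed in `Theorems/QuotientSAHeadline.lean`): `k = 4`, `P⋆`, laws `PstarPairwise.lp` ⇒
`PstarSAHeadline.TypedSALinearLevel'` again; `k = 6`, predicate `ipPred 3 = u₀u₁ ⊕ u₂u₃ ⊕ u₄u₅`, law = `(1/√2)`-biased product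
conditioned on the fibre (pairwise independent since any two of the three AND-bits are independent uniform) ⇒ linear-level SA
blindness for pure-`IP₃` range avoidance at every constant stretch; `k = t(t-1)`, the `K_t`-block constraints of the cycle
quotient of a typed `P⋆` instance with `G_L = ⊔ K_t` (law pairwise independent because the uniform measure on a coset of
`Cut(K_t) = Cycle(K_t)^⊥` is pairwise uniform, the cycle code having minimum distance `3`) ⇒ SA blindness AFTER the exact
elimination of the XOR layer (HEADLINE-22).  Literature: no Sherali–Adams lower bound driven by a BIASED (non-uniform-marginal)
pairwise-independent supporting law is known to the cell in print (BGMT 2012, Georgiou–Magen–Tulsiani 2009, Tulsiani–Worah 2013,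
Barak–Chan–Kothari 2015, Kothari–Mori–O'Donnell–Witmer 2017 all use balanced / `t`-wise UNIFORM laws); recorded as literature ask W4′.
-/

set_option linter.dupNamespace false

open Finset
open Literature.Computability.Complexity
open Summit.PneNP.PneNP.Theorems.PstarPairwise (rho)
open Summit.PneNP.PneNP.Theorems.PstarSALevel (cyl varSet bdry SAFeasible)
open Summit.PneNP.PneNP.Theorems.PstarSASDPLevel (BoundaryExpandingQ)

namespace Summit.PneNP.PneNP.Theorems.PairwiseSALevel

variable {k n m : ℕ}

/-! ### Slot marginals and pairwise-independent fibre laws -/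

/-- One-slot marginal of a weight `w` on `{0,1}^k`: the mass of `{u | u i = α}`. -/
def marg1 (w : (Fin k → Bool) → ℝ) (i : Fin k) (α : Bool) : ℝ := ∑ u, if u i = α then w u else 0

/-- Two-slot marginal of a weight `w` on `{0,1}^k`: the mass of `{u | u i = α ∧ u j = β}`. -/
def marg2 (w : (Fin k → Bool) → ℝ) (i j : Fin k) (α β : Bool) : ℝ :=
  ∑ u, if u i = α ∧ u j = β then w u else 0

/-- For arity `4` these are `PstarPairwise.pr1` / `pr2` on the nose. -/
theorem marg1_eq_pr1 (w : (Fin 4 → Bool) → ℝ) : marg1 w = PstarPairwise.pr1 w := rfl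

/-- For arity `4` the pair marginal is `PstarPairwise.pr2` on the nose. -/
theorem marg2_eq_pr2 (w : (Fin 4 → Bool) → ℝ) : marg2 w = PstarPairwise.pr2 w := rfl

/-- **Pairwise-independent fibre laws with variable-consistent biases** for the system `I(x) = y`: biases `p v ∈ (0,1)` per
VARIABLE, and for every output `j` a probability law `μ j` on its slot patterns that is supported on the fibre `{u | table j u = y j}`,
has slot marginals `Bernoulli(p (vars j s))`, and has independent slot pairs.  (BGMT's "promising predicate" is the case
`p ≡ 1/q`; typed `P⋆` is the case `p = ½` on XOR variables, `1/√2` on AND variables, `μ j = PstarPairwise.lp (√2/2) (y j)`.) -/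
structure PairwiseLaws (I : LocalMap k n m) (y : Fin m → Bool) (p : Fin n → ℝ) (μ : Fin m → (Fin k → Bool) → ℝ) : Prop where
  bias_pos : ∀ v, 0 < p v
  bias_lt_one : ∀ v, p v < 1
  nonneg : ∀ j u, 0 ≤ μ j u
  total : ∀ j, ∑ u, μ j u = 1
  support : ∀ j u, μ j u ≠ 0 → I.table j u = y j
  marg : ∀ j (s : Fin k) (α : Bool), marg1 (μ j) s α = rho (p (I.vars j s)) α
  indep : ∀ j (s s' : Fin k), s ≠ s' → ∀ α β : Bool, marg2 (μ j) s s' α β = marg1 (μ j) s α * marg1 (μ j) s' β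

/-! ### Sherali–Adams feasibility, strong (threshold) form -/

/-- **Level-`t` Sherali–Adams feasibility with support threshold `θ`**: locally consistent probability laws on all sets of at
most `t` variables, the law on `S` being supported on assignments that satisfy EVERY output constraint with at least `θ` of its
variables inside `S`.  For `θ =` (number of variables of the output) this is `PstarSALevel.SAFeasible`; smaller `θ` is stronger. -/
def SAFeasibleAt (θ t : ℕ) (I : LocalMap k n m) (y : Fin m → Bool) : Prop :=
  ∃ D : Finset (Fin n) → (Fin n → Bool) → ℝ,
    (∀ S, S.card ≤ t → (∀ x, 0 ≤ D S x) ∧ ∑ x, D S x = 1) ∧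
    (∀ S T, T ⊆ S → S.card ≤ t → ∀ a, cyl (D S) T a = cyl (D T) T a) ∧
    (∀ S (j : Fin m), S.card ≤ t → θ ≤ (varSet I j ∩ S).card → ∀ x, D S x ≠ 0 → I.eval x j = y j)

/-- The strong form is antitone in the threshold. -/
theorem SAFeasibleAt.mono {θ θ' t : ℕ} {I : LocalMap k n m} {y : Fin m → Bool} (h : SAFeasibleAt θ t I y) (hθ : θ ≤ θ') :
    SAFeasibleAt θ' t I y := by
  obtain ⟨D, hprob, hcons, hsupp⟩ := h
  exact ⟨D, hprob, hcons, fun S j hS hθ' => hsupp S j hS (hθ.trans hθ')⟩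

/-- The strong form is antitone in the level. -/
theorem SAFeasibleAt.anti {θ s t : ℕ} {I : LocalMap k n m} {y : Fin m → Bool} (h : SAFeasibleAt θ t I y) (hst : s ≤ t) :
    SAFeasibleAt θ s I y := by
  obtain ⟨D, hprob, hcons, hsupp⟩ := h
  exact ⟨D, fun S hS => hprob S (hS.trans hst), fun S T hTS hS => hcons S T hTS (hS.trans hst),
    fun S j hS => hsupp S j (hS.trans hst)⟩

/-- The strong form with threshold at most the number of variables of every output implies plain `SAFeasible`. -/
theorem SAFeasibleAt.saFeasible {θ t : ℕ} {I : LocalMap k n m} {y : Fin m → Bool} (h : SAFeasibleAt θ t I y)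
    (hθ : ∀ j, θ ≤ (varSet I j).card) : SAFeasible t I y := by
  obtain ⟨D, hprob, hcons, hsupp⟩ := h
  refine ⟨D, hprob, hcons, fun S j hS hj x hx => hsupp S j hS ?_ x hx⟩
  rw [Finset.inter_eq_left.2 hj]
  exact hθ j

/-- With injective slots every output reads exactly `k` variables. -/
theorem card_varSet_of_injective (I : LocalMap k n m) {j : Fin m} (hj : Function.Injective (I.vars j)) :
    (varSet I j).card = k := by
  unfold PstarSALevel.varSet
  rw [Finset.card_image_of_injective _ hj, Finset.card_univ, Fintype.card_fin]

/-- So for `θ ≤ k` and injective slots the strong form implies `SAFeasible`. -/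
theorem SAFeasibleAt.saFeasible_of_injective {θ t : ℕ} {I : LocalMap k n m} {y : Fin m → Bool} (h : SAFeasibleAt θ t I y)
    (hinj : ∀ j, Function.Injective (I.vars j)) (hθ : θ ≤ k) : SAFeasible t I y :=
  h.saFeasible fun j => by rw [card_varSet_of_injective I (hinj j)]; exact hθ

/-- Conversely plain `SAFeasible` is the strong form at threshold `k` (injective slots). -/
theorem saFeasibleAt_of_saFeasible {t : ℕ} {I : LocalMap k n m} {y : Fin m → Bool} (h : SAFeasible t I y)
    (hinj : ∀ j, Function.Injective (I.vars j)) : SAFeasibleAt k t I y := by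
  obtain ⟨D, hprob, hcons, hsupp⟩ := h
  refine ⟨D, hprob, hcons, fun S j hS hj x hx => hsupp S j hS ?_ x hx⟩
  have hle : (varSet I j ∩ S).card ≤ (varSet I j).card := Finset.card_le_card Finset.inter_subset_left
  have heq : varSet I j ∩ S = varSet I j :=
    Finset.eq_of_subset_of_card_le Finset.inter_subset_left (by rw [card_varSet_of_injective I (hinj j)]; exact hj)
  exact Finset.inter_eq_left.1 heq

/-! ### The hub target -/

/-- **T22.0 — BIASED BGMT (OPEN; ROUND-22 hub).**  For every arity `k ≥ 3` and every expansion ratio `a/b > k - 3` there is a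
constant `c > 0` such that: if a `k`-local map `I` with injective slots is `(r, a/b)`-boundary expanding and the system `I(x) = y`
carries pairwise-independent fibre laws with variable-consistent biases, then the fibre of `y` is Sherali–Adams feasible at level
`r / c`, in the strong form with support threshold `3`.  Proof plan: `PstarSAPeeling/PeelStep/Consistency/Closure(Q)/Assembly`
with `lp ↦ μ j`, `bias ↦ p`, "`≥ 2` private variables" ↦ "`≥ k - 2`" (`d = k - 3` in `PstarSAClosureQ.exists_peelable_of_closureQ`),
normalisers `Z = 1` and BGMT Lemma 3.2 verbatim; threshold `3` from the closure property on singleton families. -/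
@[conjecture] def PairwiseSALinearLevel : Prop :=
  ∀ k a b : ℕ, 3 ≤ k → (k - 3) * b < a → ∃ c : ℕ, 0 < c ∧
    ∀ (n m r : ℕ) (I : LocalMap k n m) (y : Fin m → Bool) (p : Fin n → ℝ) (μ : Fin m → (Fin k → Bool) → ℝ),
      (∀ j, Function.Injective (I.vars j)) → PairwiseLaws I y p μ → BoundaryExpandingQ a b r I →
      SAFeasibleAt 3 (r / c) I y

/-- The hub target in the plain-`SAFeasible` form it will mostly be consumed in. -/
theorem saFeasible_of_pairwiseSALinearLevel (h : PairwiseSALinearLevel) (k a b : ℕ) (hk : 3 ≤ k) (hab : (k - 3) * b < a) :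
    ∃ c : ℕ, 0 < c ∧ ∀ (n m r : ℕ) (I : LocalMap k n m) (y : Fin m → Bool) (p : Fin n → ℝ)
      (μ : Fin m → (Fin k → Bool) → ℝ), (∀ j, Function.Injective (I.vars j)) → PairwiseLaws I y p μ →
      BoundaryExpandingQ a b r I → SAFeasible (r / c) I y := by
  obtain ⟨c, hc, H⟩ := h k a b hk hab
  exact ⟨c, hc, fun n m r I y p μ hinj hL hB => (H n m r I y p μ hinj hL hB).saFeasible_of_injective hinj hk⟩

end Summit.PneNP.PneNP.Theorems.PairwiseSALevel
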